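import Summits.HubbardSuperconductivity.HubbardSuperconductivity.Theses.CooperPairDMottWalk
import HarnessLib

/-!
# Crux `DiluteBECBridge` and target `PureCooperPair` of route `CooperPairDMottWalk`: the dichotomy `PureCooperPair ∨ DiluteBECBridge`

Helper for route `CooperPairDMottWalk` (`--supports stmt-HubbardSuperconductivity-10314`, crux
`DiluteBECBridge`; the crux is shared verbatim with route `HyperoctahedralMott`). The BEC-side bridge
reads `∀ U ∈ [2, 8], CP(U) → ∃ δ ∈ (0, 1/2), SummitBody(U, δ)`, where `CP(U)` — the `L`-uniform
pure-model Cooper pair on the sides `4k + 4` ((a) two-hole binding, (b) unique `(L² - 2, S^z = 0)`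
ground state, (c) macroscopic `d_{x²-y²}` pair amplitude against the half-filled ground state) — is,
word for word, the body of the route's TARGET `PureCooperPair` (`∃ U ∈ [2, 8], CP(U)`, item
stmt-HubbardSuperconductivity-1175) at `U`: the planner copied it verbatim so that the Assembly
`closes` composes syntactically. Five sorry-free consequences, recorded for the planner and the ledger:

* `diluteBECBridge_of_not_pureCooperPair` — if the target fails (no `U ∈ [2, 8]` carries an
  `L`-uniform Cooper pair), the crux holds VACUOUSLY at every `U` of the window: a refutation of item
  stmt-HubbardSuperconductivity-1175 closes item stmt-HubbardSuperconductivity-10314 by this one-line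
  theorem;
* `pureCooperPair_of_not_diluteBECBridge` — contrapositive: any refutation of the crux is a proof of
  the target (it must exhibit a `U ∈ [2, 8]` at which `CP(U)` holds);
* `pureCooperPair_or_diluteBECBridge` — at least one of the two open items is TRUE; the route's open
  content is their conjunction, never the bridge alone;
* `diluteBECBridge_of_summit_on_window` — conversely the crux follows from the summit's matrix on the
  window `∀ U ∈ [2, 8], ∃ δ ∈ (0, 1/2), SummitBody(U, δ)` with the Cooper-pair hypothesis UNUSED;
* `diluteBECBridge_iff_pointwise` — the crux in pointwise normal form: at each `U ∈ [2, 8]` its content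
  is exactly `¬ CP(U) ∨ ∃ δ ∈ (0, 1/2), SummitBody(U, δ)`.

Hence the truth value of the crux is undetermined in the tree before the target is settled:
`¬PureCooperPair ⇒ DiluteBECBridge` outright, and `CP(U₀)` at a witness `U₀` turns the crux at `U₀`
into the summit's matrix `∃ δ ∈ (0, 1/2), SummitBody(U₀, δ)` (every-ground-state normal form:
`diluteBECBridge_iff_everyGSOrder`, `Theorems/CooperPairDMottWalkDiluteBECBridgeNormalForm`). Pure logic
on the literal route terms; no definition is introduced. References: the route card (planner
Sketch.lean); D. P. Arovas, E. Berg, S. A. Kivelson, S. Raghu, Annu. Rev. Condens. Matter Phys. 13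
(2022) 239, §9. [folklore]
-/

-- the mandated namespace `Summit.<Summit>.<Problem>.Theorems` repeats `HubbardSuperconductivity`
-- (single-problem summit, D-0017), which the `dupNamespace` linter flags on every declaration
set_option linter.dupNamespace false

noncomputable section

namespace Summit.HubbardSuperconductivity.HubbardSuperconductivity.Theorems.CooperPairDMottWalk

open Matrix
open Literature.Probability.LatticeModels Literature.MathematicalPhysics.QuantumLattice
open Summit.HubbardSuperconductivity.HubbardSuperconductivity.Theses.CooperPairDMottWalk

/-- **The crux from the failure of the target.** If `PureCooperPair` is false — no `U ∈ [2, 8]`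
carries an `L`-uniform pure-model Cooper pair (a) ∧ (b) ∧ (c) on the sides `4k + 4` — then the
hypothesis of `DiluteBECBridge` fails at every `U` of the window and the bridge holds vacuously.
So a refutation of item stmt-HubbardSuperconductivity-1175 closes item
stmt-HubbardSuperconductivity-10314 at once. [folklore] -/
theorem diluteBECBridge_of_not_pureCooperPair : ¬ PureCooperPair → DiluteBECBridge := by
  intro hX U hU hCP
  exact absurd ⟨U, hU, hCP⟩ hX

/-- **Contrapositive: refuting the crux proves the target.** Any proof of `¬ DiluteBECBridge` must
exhibit a `U ∈ [2, 8]` at which the `L`-uniform Cooper pair `CP(U)` holds (and `d`-wave order fails at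
every doping), in particular it proves `PureCooperPair`. [folklore] -/
theorem pureCooperPair_of_not_diluteBECBridge : ¬ DiluteBECBridge → PureCooperPair := by
  intro h
  by_contra hX
  exact h (diluteBECBridge_of_not_pureCooperPair hX)

/-- **Dichotomy.** At least one of the route's target `PureCooperPair` (item
stmt-HubbardSuperconductivity-1175) and its BEC-side bridge `DiluteBECBridge` (item
stmt-HubbardSuperconductivity-10314) is true. [folklore] -/
theorem pureCooperPair_or_diluteBECBridge : PureCooperPair ∨ DiluteBECBridge := by
  by_cases hX : PureCooperPair
  · exact Or.inl hX
  · exact Or.inr (diluteBECBridge_of_not_pureCooperPair hX)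

/-- **The crux from the summit's matrix on the window, Cooper pair unused.** If for every
`U ∈ [2, 8]` some doping `δ ∈ (0, 1/2)` has `d_{x²-y²}` pair-field long-range order of every
admissible `(2⌊(1-δ)L²/2⌋, S^z = 0)` ground-state sequence of the pure torus (the summit's body at
`(U, δ)`), then `DiluteBECBridge` holds — its two-hole hypothesis is not consumed. Together with
`diluteBECBridge_of_not_pureCooperPair` this brackets the crux between `¬ CP` and the summit's matrix
on the window. [folklore] -/
theorem diluteBECBridge_of_summit_on_window :
    (∀ U ∈ Set.Icc (2 : ℝ) 8, ∃ δ ∈ Set.Ioo (0 : ℝ) (1 / 2),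
      ∀ (N : ℕ → ℕ) (ψ : ∀ L, Fock (Orb (FermionTorus 2 L))),
        (∀ L, Even L → N L = 2 * ⌊(1 - δ) * (L : ℝ) ^ 2 / 2⌋₊ ∧ star (ψ L) ⬝ᵥ ψ L = 1 ∧
            IsGroundStateInSector (hubbardTorus 2 L 1 U) (N L) 0 (ψ L)) →
          HasLongRangeOrder (fun k => halfOpenBox 2 (2 * k))
            (fun k => torusPullback (pairFieldCorr dWaveFormFactor ψ) (2 * k))) →
      DiluteBECBridge := by
  intro h U hU _
  exact h U hU

/-- **`DiluteBECBridge` in pointwise normal form.** For each `U ∈ [2, 8]` the content of the crux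
is exactly the disjunction "no `L`-uniform pure-model Cooper pair at `U`, or the summit's matrix at
`U` for some doping `δ ∈ (0, 1/2)`"; both disjuncts are open at every `U` of the window (the first is
the negation of the target's body at `U`). [folklore] -/
theorem diluteBECBridge_iff_pointwise :
    DiluteBECBridge ↔
      (let CP := fun (L : ℕ) [NeZero L]
          (H : Matrix (Finset (Orb (FermionTorus 2 L))) (Finset (Orb (FermionTorus 2 L))) ℂ)
          (ε z : ℝ) =>
        H.minEnergyOn (szSector (L ^ 2 - 2) 0) + H.minEnergyOn (szSector (L ^ 2) 0) + ε ≤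
            2 * H.minEnergyOn (szSector (L ^ 2 - 1) (1 / 2)) ∧
          (∀ φ₁ φ₂, IsGroundStateInSector H (L ^ 2 - 2) 0 φ₁ →
            IsGroundStateInSector H (L ^ 2 - 2) 0 φ₂ → ∃ c : ℂ, φ₂ = c • φ₁) ∧
          (∀ φ₀ φ₂, IsGroundStateInSector H (L ^ 2) 0 φ₀ →
            IsGroundStateInSector H (L ^ 2 - 2) 0 φ₂ →
              z * (L : ℝ) ^ 2 * (star φ₀ ⬝ᵥ φ₀).re * (star φ₂ ⬝ᵥ φ₂).re ≤
                ‖star φ₂ ⬝ᵥ (pairField dWaveFormFactor L *ᵥ φ₀)‖ ^ 2)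
      ∀ U ∈ Set.Icc (2 : ℝ) 8,
        (¬ ∃ ε > (0 : ℝ), ∃ z > (0 : ℝ), ∃ k₀ : ℕ, ∀ k ≥ k₀,
            CP (4 * k + 4) (hubbardTorus 2 (4 * k + 4) 1 U) ε z) ∨
          ∃ δ ∈ Set.Ioo (0 : ℝ) (1 / 2),
            ∀ (N : ℕ → ℕ) (ψ : ∀ L, Fock (Orb (FermionTorus 2 L))),
              (∀ L, Even L → N L = 2 * ⌊(1 - δ) * (L : ℝ) ^ 2 / 2⌋₊ ∧ star (ψ L) ⬝ᵥ ψ L = 1 ∧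
                  IsGroundStateInSector (hubbardTorus 2 L 1 U) (N L) 0 (ψ L)) →
                HasLongRangeOrder (fun k => halfOpenBox 2 (2 * k))
                  (fun k => torusPullback (pairFieldCorr dWaveFormFactor ψ) (2 * k))) :=
  ⟨fun h U hU => imp_iff_not_or.1 (h U hU), fun h U hU => imp_iff_not_or.2 (h U hU)⟩

end Summit.HubbardSuperconductivity.HubbardSuperconductivity.Theorems.CooperPairDMottWalk
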